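import Literature.MathematicalPhysics.QuantumFieldTheory.Balaban1983to89.Node00.OpsYSectDE

/-!
# `Balaban1983to89.B9Ineq349SiteReading` — T. Bałaban, *Propagators for lattice gauge theories in a background field*, Commun. Math. Phys. **99**
# (1985) 389–434 [Balaban1985BackgroundPropagators], (3.49) p. 399 with (3.21)∕(3.25) pp. 394–395: THE SITE-SECTOR (3.49) READING OF THE GENUINE
# LETTER `P = I − R(U) = G′Q′*(Q′G′²Q′*)⁻¹Q′G′` AND THE N06 OPERATOR LAYER WITH THAT READING IN ITS `P349` FIELD (ROW 25 OF THE N06 TABLE, GENUINE)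

statement-level skeleton of published theorems with citation tags; proofs where landed; nothing here is a claim about the Yang–Mills mass gap

THE PRINT.  p. 394 [PDF 6]: *«R = R(U) is an orthogonal projection in the Hilbert space L²(Ω₀, 𝔤) onto the subspace R = Δ^η_U N(Q′) … (3.21)»*,
*«Rf = (I − G′Q′*(Q′G′²Q′*)⁻¹Q′G′)f, (3.25) where G′ = G′(U) = (Δ′_a)⁻¹»*; p. 395: *«Δ_a(U) = Δ(U) + D R(U) D* + Q*(U)aQ(U), (3.26)»* — so `R`, and
`P = I − R`, act on (𝔤-valued) SITE functions and `D` (the covariant derivative `D^η_U = η⁻¹∇_U`, (3.3)) maps them to bond functions.  p. 399 [PDF 11]: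
*«For the operator P = I − R we obtain, using again Lemma 2.1, [|P(x, x′)|, |(DP)_μ(x, x′)|, |(PD*)_ν(x, x′)|, |(DPD*)_{μν}(x, x′)|] ≤ O(1)[1, (L^jη)⁻¹,
(L^jη)⁻¹, (L^jη)⁻²](L^{j′}η)^{−d}e^{−½δ₀d(y,y′)} for x ∈ Δ(y), y ∈ Λ_j, x′ ∈ Δ(y′), y′ ∈ Λ_{j′}. (3.49)»* — four kernels indexed by SITE pairs.

WHY THIS FILE (dag-n06-i = bundle F4, rows 14·25·26 of the N06 table; row 25 = `s349 : B9.Stmt349Printed …(ops x).P349`).  def-Y's interface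
`Node00.CovLettersY` carries `P349 : BondOpY` (an operator on fine-BOND functions) read by `Node00.fineKernelOfOp`; the printed `P` is the SITE-sector
operator above, so no genuine letter can inhabit that slot (dag-n06-i `ROW25-LOCATED.md` (O1); def-Y `Node00.OpsYSectDE` header (M8)) and def-Y's v3
record `lettersYOfRecordDE` leaves it at the flat `0` — row 25 is VACUOUS at `opsYOfRecordDE` (`B9RecordDELettersVacuity.s349_opsYOfRecord_vacuous`
pattern).  Meanwhile the genuine LETTER is in the tree: def-Y's `Node00.P349Y i parS Gp := U ↦ 1 − RY i parS Gp U` with `RY = 1 − G′Q′*(Q′G′²Q′*)⁻¹Q′G′`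
(3.25) over the taxicab transporters and `G′ = GpY`.  Only its (3.49) READING was missing.  This file supplies it and puts it in the `P349` field of the
operator layer, touching nothing else: no interface changes, every other field of the layer is def-Y's by `rfl`.

WHAT IS DEFINED AND PROVED (sorry-free; no inequality of the paper is proved).
* §1 `dpow349 = (0,1,1,2)`; ★ `fineEntryS i O U s s′ n` — THE FOUR (3.49) ENTRIES OF A SITE-SECTOR LETTER `O` AT A BLOCK PAIR `(s, s′)` IN PRINT'S UNITS:
  `(η⁻¹)^{d′+dpow n} · sup_{‖E‖≤1} sup_{x′∈Δ(s′)} [sup_{x∈Δ(s)}‖(O_U(δ_{x′}⊗E))(x)‖, sup_{x∈Δ(s),μ}‖(∇_{U,μ}O_U(δ_{x′}⊗E))(x)‖, sup_ν sup_{x∈Δ(s)}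
  ‖(O_U∇*_{U,ν}(δ_{x′}⊗E))(x)‖, sup_ν sup_{x∈Δ(s),μ}‖(∇_{U,μ}O_U∇*_{U,ν}(δ_{x′}⊗E))(x)‖]ₙ` (`d′ = d + 1` the spatial dimension; the kernel of an operator
  on `L²(T_η)` w.r.t. the `η^{d′}`-measure is `η^{−d′}`× its matrix on lattice deltas, and `D = η⁻¹∇_U`, `D* = η⁻¹∇*_U` — the same convention as [4]'s
  `B6Ineq288MultiLevelTorus.dPdP = η^{−2−(d+1)}·dPd`); ★ `fineKernelOfSiteOp i B cfg O : B9.FineKernel (geo9K i) B` — the reading at the carrier blocks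
  `β` of the index bonds (the SITE twin of def-Y's `fineKernelOfOp`); `fineEntryS_nonneg`, `fineEntryS_zero`, `fineKernelOfSiteOp_zero_ker`.
* §2 def-Y's letter: `one_sub_rK : 1 − rK i = pM i.D` ([4]'s `P` matrix), ★ `P349Y_eq_comp : P349Y i parS Gp U = Gp U ∘ Q′*_U ∘ (Q′G′²Q′*)⁻¹_U ∘ Q′_U ∘
  Gp U` ((3.25): three factors, no identity term), `P349Y_one : P349Y i parS Gp 1 = liftMatY 𝔸 (pM i.D)` under the printed `U = 1` clauses, `P349Y_one_liftY`.
* §3 ★ `p349SiteY 𝔸 G x 𝔏` — the (3.49) reading of `P349Y` over a letter record's OWN `parS`, `Gp`; ★ `operatorLayerYS349 𝔸 G x 𝔏 𝔈 := { operatorLayerYOfLetters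
  … with P349 := p349SiteY … }` with one `rfl` lemma per field; ★★ `opsYS349OfLetters N θ M⋆ 𝔏 𝔈`, ★★ `opsYS349OfRecordDE N θ M⋆ 𝔯 𝔈 := opsYS349OfLetters …
  (lettersYOfRecordDE N θ M⋆ 𝔯) 𝔈` = def-Y's `opsYOfRecordDE` WITH THE GENUINE (3.49) READING in `P349` and every other field `rfl`-equal
  (`opsYS349OfLetters_eq_update`-type lemmas field by field, `Y9OfRecord_opsYS349OfRecordDE`); `s349_opsYS349OfLetters_iff` (`Iff.rfl`): at this
  instance ROW 25 IS THE GENUINE OBLIGATION `B9.Stmt349Printed (θ.d₆+1) c35 geo9Y (bg9Y …) (x ↦ p349SiteY … (𝔏 x))` — print's (3.49) for the genuine `P`,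
  read at carrier blocks; a HYPOTHESIS (print derives it from Thms 3.1–3.2 + Lemma 2.1; at the β-read geometry `geo9Y` that derivation is obstructed,
  `ROW25-LOCATED.md` (O2)), no longer a vacuity.
(Row 26 — (3.132) at the v3 record from four estimate binders — is the sibling `B9Eq3132AtRecordDE`; its statement transports to the §3 instance by
`opsYS349OfRecordDE_QGQinv ∕ _QG1Qinv`, `rfl`.)

HONEST SCOPE.  Definitions of READINGS (norm functionals of a given operator) + `rfl` bookkeeping; (3.49) remains a HYPOTHESIS of the N06 knit (a
printed statement, now about a genuine operator); count-neutral; NOT a node discharge; nothing continuum ∕ OS ∕ mass-gap.  Filed by dag-n06-i gen 6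
(pub-ymgap N06 bundle F4); a NEW file; nothing landed is modified.
-/

namespace Literature.MathematicalPhysics.QuantumFieldTheory.Balaban1983to89.B9Ineq349SiteReading

open Node00
open B6KLevelCensusIndexV1 (KIdx)
open B6Geom246MultiLevelBox (bset blkOf)
open B6Ineq2142KLevelV1 (β)
open B6Ineq288MultiLevelTorus (pM rM one_sub_rM)
open B9PinMembersKLevelV1 (MemberY geo9Y bg9Y)
open B9PinCarriersKLevelV1 (OperatorLayerY carriersY)
open B7Prop2SpecialUnitary (specialUnitaryUnits)
open scoped Matrix

noncomputable section

variable {d ℓ : ℕ} {hd : 1 ≤ d + 1} {hL : Odd (ℓ + 1) ∧ 1 < ℓ + 1} {b₀ b₁ : ℝ} {Mstar : ℕ}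
variable {𝔸 : Type} [NormedRing 𝔸] [NormedAlgebra ℂ 𝔸] [CompleteSpace 𝔸]

/-! ## §1 The site-sector (3.49) reading -/

section Reading

variable (i : KIdx d ℓ hd hL b₀ b₁)

/-- the number of covariant derivatives in the n-th kernel of (3.49): `P, DP, PD*, DPD*` ↦ `0, 1, 1, 2` (each `D = η⁻¹∇_U` costs one `η⁻¹`).
[cite: Balaban1985BackgroundPropagators, (3.49) p.399, (3.3) p.390] -/
def dpow349 : Fin 4 → ℕ := ![0, 1, 1, 2]

open Classical in
/-- ★ **THE FOUR (3.49) ENTRIES OF A SITE-SECTOR LETTER AT A BLOCK PAIR, PRINT'S UNITS**: for `O = P(U)` on `𝔸`-valued site functions and blocks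
`s = Δ(y)`, `s′ = Δ(y′)`, entry `n` is `(η⁻¹)^{d′ + dpow n}` times the sup over `‖E‖ ≤ 1`, `x′ ∈ Δ(y′)` of
`[sup_{x∈Δ(y)} ‖(O_U(δ_{x′}⊗E))(x)‖, sup_{x∈Δ(y),μ} ‖(∇_{U,μ}O_U(δ_{x′}⊗E))(x)‖, sup_ν sup_{x∈Δ(y)} ‖(O_U∇*_{U,ν}(δ_{x′}⊗E))(x)‖,
sup_ν sup_{x∈Δ(y),μ} ‖(∇_{U,μ}O_U∇*_{U,ν}(δ_{x′}⊗E))(x)‖]ₙ` — the matrix entries `P(x,x′)`, `(DP)_μ(x,x′)`, `(PD*)_ν(x,x′)`, `(DPD*)_{μν}(x,x′)` as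
operators on the fibre, kernels w.r.t. the `η^{d′}` lattice measure (`d′ = d + 1`). [cite: Balaban1985BackgroundPropagators, (3.49) p.399] -/
def fineEntryS (O : SiteOpY 𝔸 i) (U : CfgY 𝔸 i) (s s' : BlkY i) (n : Fin 4) : ℝ :=
  (etaS i)⁻¹ ^ (d + 1 + dpow349 n) *
    ⨆ E : BallY 𝔸, ⨆ x' : {z : SiteY i // blkOf i.D.toDomains z = s'},
      ((![supBlkS i s (O U (deltaY x'.1 (E : 𝔸))),
          supBlkS' i s (fun μ => cdS i U μ (O U (deltaY x'.1 (E : 𝔸)))),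
          ⨆ ν : Fin (d + 1), supBlkS i s (O U (cdsS i U ν (deltaY x'.1 (E : 𝔸)))),
          ⨆ ν : Fin (d + 1), supBlkS' i s (fun μ => cdS i U μ (O U (cdsS i U ν (deltaY x'.1 (E : 𝔸)))))] : Fin 4 → ℝ) n)

/-- ★ **THE `B9.FineKernel` READING (3.49) OF A SITE-SECTOR LETTER** at the carrier blocks `β` of NODE 00's index bonds (the site-sector twin of
def-Y's `fineKernelOfOp`). [cite: Balaban1985BackgroundPropagators, (3.49) p.399] -/
def fineKernelOfSiteOp (B : B9.Backgrounds) (cfg : B.Cfg → CfgY 𝔸 i) (O : SiteOpY 𝔸 i) : B9.FineKernel (B9GeoNormsKLevelV1.geo9K i) B :=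
  ⟨fun n U b b' => fineEntryS i O (cfg U) (β i.hN i.D i.hk b) (β i.hN i.D i.hk b') n⟩

/-- the reading, unfolded. [cite: Balaban1985BackgroundPropagators, (3.49) p.399, bookkeeping] -/
theorem fineKernelOfSiteOp_ker (B : B9.Backgrounds) (cfg : B.Cfg → CfgY 𝔸 i) (O : SiteOpY 𝔸 i) (n : Fin 4) (U : B.Cfg) (b b' : IBondY i) :
    (fineKernelOfSiteOp i B cfg O).ker n U b b' = fineEntryS i O (cfg U) (β i.hN i.D i.hk b) (β i.hN i.D i.hk b') n := rfl

omit [NormedAlgebra ℂ 𝔸] [CompleteSpace 𝔸] in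
/-- a block sup of norms is `≥ 0`. [cite: Balaban1985BackgroundPropagators, (3.42) p.397, bookkeeping] -/
theorem supBlkS_nonneg (s : BlkY i) (Ψ : SiteY i → 𝔸) : 0 ≤ supBlkS i s Ψ := by
  classical
  unfold supBlkS
  exact Real.iSup_nonneg fun z => by split_ifs <;> simp

omit [NormedAlgebra ℂ 𝔸] [CompleteSpace 𝔸] in
/-- a directional block sup of norms is `≥ 0`. [cite: Balaban1985BackgroundPropagators, (3.42) p.397, bookkeeping] -/
theorem supBlkS'_nonneg (s : BlkY i) (Ψ : Fin (d + 1) → SiteY i → 𝔸) : 0 ≤ supBlkS' i s Ψ := by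
  classical
  unfold supBlkS'
  exact Real.iSup_nonneg fun p => by split_ifs <;> simp

/-- every (3.49) entry is `≥ 0`. [cite: Balaban1985BackgroundPropagators, (3.49) p.399, bookkeeping] -/
theorem fineEntryS_nonneg (O : SiteOpY 𝔸 i) (U : CfgY 𝔸 i) (s s' : BlkY i) (n : Fin 4) : 0 ≤ fineEntryS i O U s s' n := by
  unfold fineEntryS
  refine mul_nonneg (pow_nonneg (inv_nonneg.2 ?_) _) (Real.iSup_nonneg fun E => Real.iSup_nonneg fun x' => ?_)
  · unfold etaS; positivity
  · fin_cases n
    · exact supBlkS_nonneg i s (O U (deltaY x'.1 (E : 𝔸)))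
    · exact supBlkS'_nonneg i s (fun μ => cdS i U μ (O U (deltaY x'.1 (E : 𝔸))))
    · exact Real.iSup_nonneg fun ν => supBlkS_nonneg i s (O U (cdsS i U ν (deltaY x'.1 (E : 𝔸))))
    · exact Real.iSup_nonneg fun ν => supBlkS'_nonneg i s (fun μ => cdS i U μ (O U (cdsS i U ν (deltaY x'.1 (E : 𝔸)))))

omit [NormedAlgebra ℂ 𝔸] [CompleteSpace 𝔸] in
/-- the block sup of the zero function is `0`. [cite: Balaban1985BackgroundPropagators, (3.42) p.397, bookkeeping] -/
theorem supBlkS_zero (s : BlkY i) : supBlkS i s (0 : SiteY i → 𝔸) = 0 := by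
  classical
  unfold supBlkS
  simp

omit [NormedAlgebra ℂ 𝔸] [CompleteSpace 𝔸] in
/-- the directional block sup of the zero function is `0`. [cite: Balaban1985BackgroundPropagators, (3.42) p.397, bookkeeping] -/
theorem supBlkS'_zero (s : BlkY i) : supBlkS' i s (fun _ => (0 : SiteY i → 𝔸)) = 0 := by
  classical
  unfold supBlkS'
  simp

/-- `∇_{U,μ} 0 = 0`. [cite: Balaban1985BackgroundPropagators, (3.3) p.390, bookkeeping] -/
theorem cdS_zero (U : CfgY 𝔸 i) (μ : Fin (d + 1)) : cdS i U μ (0 : SiteY i → 𝔸) = 0 := by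
  have h := cdS_smul i U μ (0 : ℂ) (0 : SiteY i → 𝔸)
  simpa using h

/-- `∇*_{U,μ} 0 = 0`. [cite: Balaban1985BackgroundPropagators, (3.8) p.392, bookkeeping] -/
theorem cdsS_zero (U : CfgY 𝔸 i) (μ : Fin (d + 1)) : cdsS i U μ (0 : SiteY i → 𝔸) = 0 := by
  have h := cdsS_smul i U μ (0 : ℂ) (0 : SiteY i → 𝔸)
  simpa using h

/-- the (3.49) entries of the ZERO letter are `0` (a flat letter reads `0`: the vacuity mechanism of `B9RecordDELettersVacuity`).
[cite: Balaban1985BackgroundPropagators, (3.49) p.399, bookkeeping] -/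
theorem fineEntryS_zero (U : CfgY 𝔸 i) (s s' : BlkY i) (n : Fin 4) :
    fineEntryS i (fun _ => (0 : (SiteY i → 𝔸) →ₗ[ℂ] (SiteY i → 𝔸))) U s s' n = 0 := by
  unfold fineEntryS
  have h0 : ∀ (E : BallY 𝔸) (x' : {z : SiteY i // blkOf i.D.toDomains z = s'}),
      ((![supBlkS i s ((0 : (SiteY i → 𝔸) →ₗ[ℂ] (SiteY i → 𝔸)) (deltaY x'.1 (E : 𝔸))),
          supBlkS' i s (fun μ => cdS i U μ ((0 : (SiteY i → 𝔸) →ₗ[ℂ] (SiteY i → 𝔸)) (deltaY x'.1 (E : 𝔸)))),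
          ⨆ ν : Fin (d + 1), supBlkS i s ((0 : (SiteY i → 𝔸) →ₗ[ℂ] (SiteY i → 𝔸)) (cdsS i U ν (deltaY x'.1 (E : 𝔸)))),
          ⨆ ν : Fin (d + 1), supBlkS' i s (fun μ => cdS i U μ ((0 : (SiteY i → 𝔸) →ₗ[ℂ] (SiteY i → 𝔸))
            (cdsS i U ν (deltaY x'.1 (E : 𝔸)))))] : Fin 4 → ℝ) n) = 0 := by
    intro E x'
    fin_cases n
    · show supBlkS i s ((0 : (SiteY i → 𝔸) →ₗ[ℂ] (SiteY i → 𝔸)) (deltaY x'.1 (E : 𝔸))) = 0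
      rw [LinearMap.zero_apply, supBlkS_zero]
    · show supBlkS' i s (fun μ => cdS i U μ ((0 : (SiteY i → 𝔸) →ₗ[ℂ] (SiteY i → 𝔸)) (deltaY x'.1 (E : 𝔸)))) = 0
      simp only [LinearMap.zero_apply, cdS_zero, supBlkS'_zero]
    · show (⨆ ν : Fin (d + 1), supBlkS i s ((0 : (SiteY i → 𝔸) →ₗ[ℂ] (SiteY i → 𝔸)) (cdsS i U ν (deltaY x'.1 (E : 𝔸))))) = 0
      simp only [LinearMap.zero_apply, supBlkS_zero, ciSup_const]
    · show (⨆ ν : Fin (d + 1), supBlkS' i s (fun μ => cdS i U μ ((0 : (SiteY i → 𝔸) →ₗ[ℂ] (SiteY i → 𝔸))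
        (cdsS i U ν (deltaY x'.1 (E : 𝔸)))))) = 0
      simp only [LinearMap.zero_apply, cdS_zero, supBlkS'_zero, ciSup_const]
  simp only [h0, ciSup_const, Real.iSup_const_zero, mul_zero]

/-- the (3.49) reading of the zero letter is `0`. [cite: Balaban1985BackgroundPropagators, (3.49) p.399, bookkeeping] -/
theorem fineKernelOfSiteOp_zero_ker (B : B9.Backgrounds) (cfg : B.Cfg → CfgY 𝔸 i) (n : Fin 4) (U : B.Cfg) (b b' : IBondY i) :
    (fineKernelOfSiteOp i B cfg (fun _ => (0 : (SiteY i → 𝔸) →ₗ[ℂ] (SiteY i → 𝔸)))).ker n U b b' = 0 :=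
  fineEntryS_zero i (cfg U) _ _ n

end Reading

/-! ## §2 def-Y's letter `P349Y = I − R(U)`: the three-factor form (3.25) and the `U = 1` face ([4]'s `P`) -/

section Letter

variable (i : KIdx d ℓ hd hL b₀ b₁)

/-- `1 − rK = pM`: [4]'s `P = G′Q′*(Q′G′²Q′*)⁻¹Q′G′` matrix of (2.17) (`rK i = rM i.D = 1 − pM i.D`). [cite: Balaban1984PropagatorsII, (2.17) p.225; Balaban1985BackgroundPropagators, (3.25) p.394] -/
theorem one_sub_rK : 1 - rK i = pM i.D := one_sub_rM i.D

variable {i}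
variable {parS : SiteParY 𝔸 i} {Gp : SiteOpY 𝔸 i}

/-- ★ **(3.25) IN THREE FACTORS**: `P(U) = I − R(U) = G′(U) ∘ Q′*(U) ∘ (Q′G′²Q′*)⁻¹(U) ∘ Q′(U) ∘ G′(U)` — no identity term.
[cite: Balaban1985BackgroundPropagators, (3.25) p.394, (3.49) p.399 («P = I − R»)] -/
theorem P349Y_eq_comp (parS : SiteParY 𝔸 i) (Gp : SiteOpY 𝔸 i) (U : CfgY 𝔸 i) :
    P349Y i parS Gp U = Gp U ∘ₗ QpsY i parS U ∘ₗ XinvY i parS Gp U ∘ₗ QpY i parS U ∘ₗ Gp U := by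
  unfold P349Y RY
  exact sub_sub_cancel _ _

/-- ★ **`P(1)` IS THE LIFT OF [4]'s `P` MATRIX `pM`** under the printed `U = 1` clauses of the transporters and of `G′`.
[cite: Balaban1985BackgroundPropagators, (3.25) p.394 + Cor. 3.5 p.407 («for U = 1 … proved in [4]»); Balaban1984PropagatorsII, (2.17) p.225] -/
theorem P349Y_one (hparS : ∀ z w, parS (fun _ _ => 1) z w = 1)
    (hGp : ∀ (f : SiteY i → ℝ) (E : 𝔸), Gp (fun _ _ => 1) (liftY f E) = liftY ((toKT i).G *ᵥ f) E) :
    P349Y i parS Gp (fun _ _ => 1) = liftMatY (X := SiteY i) (Y := SiteY i) 𝔸 (pM i.D) := by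
  unfold P349Y
  rw [RY_one i hparS hGp, ← liftMatY_one 𝔸, ← liftMatY_sub]
  exact congrArg (liftMatY 𝔸) (one_sub_rK i)

/-- `P(1)` on product forms: `P(1)(f ⊗ E) = (pM·f) ⊗ E`. [cite: Balaban1985BackgroundPropagators, (3.25) p.394 + Cor. 3.5 p.407; Balaban1984PropagatorsII, (2.17) p.225] -/
theorem P349Y_one_liftY (hparS : ∀ z w, parS (fun _ _ => 1) z w = 1)
    (hGp : ∀ (f : SiteY i → ℝ) (E : 𝔸), Gp (fun _ _ => 1) (liftY f E) = liftY ((toKT i).G *ᵥ f) E)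
    (f : SiteY i → ℝ) (E : 𝔸) :
    P349Y i parS Gp (fun _ _ => 1) (liftY f E) = liftY ((pM i.D : Matrix (SiteY i) (SiteY i) ℝ) *ᵥ f) E := by
  rw [P349Y_one hparS hGp, liftMatY_liftY]

end Letter

/-! ## §3 The reading at a member and the operator layer with the genuine `P349` field -/

section Layer

variable (𝔸) (G : Subgroup 𝔸ˣ)

/-- ★ **THE (3.49) READING OF THE GENUINE `P = I − R(U)` OVER A LETTER RECORD'S OWN `parS`, `Gp`** (at def-Y's records of record: the taxicab
transporters and `G′ = GpY`). [cite: Balaban1985BackgroundPropagators, (3.49) p.399 with (3.25) p.394] -/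
def p349SiteY (x : MemberY d ℓ hd hL b₀ b₁ Mstar) (𝔏 : CovLettersY 𝔸 x) : B9.FineKernel (geo9Y x) (bg9Y 𝔸 G x) :=
  fineKernelOfSiteOp x.toKIdx (bg9Y 𝔸 G x) (fun U => U) (P349Y x.toKIdx 𝔏.parS 𝔏.Gp)

/-- ★ **THE OPERATOR LAYER READ FROM THE LETTERS, WITH THE SITE-SECTOR (3.49) READING OF `P349Y` IN THE `P349` FIELD** — every other field is
`operatorLayerYOfLetters`'s. [cite: Balaban1985BackgroundPropagators, Thms 3.1–3.15 pp.397–432, (3.49) p.399] -/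
def operatorLayerYS349 (x : MemberY d ℓ hd hL b₀ b₁ Mstar) (𝔏 : CovLettersY 𝔸 x) (𝔈 : ExpLettersY 𝔸 G x) :
    OperatorLayerY d ℓ hd hL b₀ b₁ Mstar 𝔸 G x :=
  { operatorLayerYOfLetters 𝔸 G x 𝔏 𝔈 with P349 := p349SiteY 𝔸 G x 𝔏 }

variable {𝔸 G}
variable (x : MemberY d ℓ hd hL b₀ b₁ Mstar) (𝔏 : CovLettersY 𝔸 x) (𝔈 : ExpLettersY 𝔸 G x)

/-- the `P349` field IS the site-sector reading of `P349Y`. [cite: Balaban1985BackgroundPropagators, (3.49) p.399, bookkeeping] -/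
theorem operatorLayerYS349_P349 : (operatorLayerYS349 𝔸 G x 𝔏 𝔈).P349 = p349SiteY 𝔸 G x 𝔏 := rfl
/-- unchanged field. [cite: Balaban1985BackgroundPropagators, Thm 3.1 p.397, bookkeeping] -/
theorem operatorLayerYS349_Gp : (operatorLayerYS349 𝔸 G x 𝔏 𝔈).Gp = (operatorLayerYOfLetters 𝔸 G x 𝔏 𝔈).Gp := rfl
/-- unchanged field. [cite: Balaban1985BackgroundPropagators, Thm 3.3 p.399, bookkeeping] -/
theorem operatorLayerYS349_GA : (operatorLayerYS349 𝔸 G x 𝔏 𝔈).GA = (operatorLayerYOfLetters 𝔸 G x 𝔏 𝔈).GA := rfl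
/-- unchanged field. [cite: Balaban1985BackgroundPropagators, Thm 3.2 p.398, bookkeeping] -/
theorem operatorLayerYS349_Cinv : (operatorLayerYS349 𝔸 G x 𝔏 𝔈).Cinv = (operatorLayerYOfLetters 𝔸 G x 𝔏 𝔈).Cinv := rfl
/-- unchanged field. [cite: Balaban1985BackgroundPropagators, (3.37) p.396, bookkeeping] -/
theorem operatorLayerYS349_IsAnalyticExt : (operatorLayerYS349 𝔸 G x 𝔏 𝔈).IsAnalyticExt = (operatorLayerYOfLetters 𝔸 G x 𝔏 𝔈).IsAnalyticExt := rfl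
/-- unchanged field. [cite: Balaban1985BackgroundPropagators, Thm 3.7 p.409, bookkeeping] -/
theorem operatorLayerYS349_E37 : (operatorLayerYS349 𝔸 G x 𝔏 𝔈).E37 = (operatorLayerYOfLetters 𝔸 G x 𝔏 𝔈).E37 := rfl
/-- unchanged field. [cite: Balaban1985BackgroundPropagators, Thm 3.9 p.414, bookkeeping] -/
theorem operatorLayerYS349_EK39 : (operatorLayerYS349 𝔸 G x 𝔏 𝔈).EK39 = (operatorLayerYOfLetters 𝔸 G x 𝔏 𝔈).EK39 := rfl
/-- unchanged field. [cite: Balaban1985BackgroundPropagators, Thm 3.10 p.416, bookkeeping] -/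
theorem operatorLayerYS349_E310 : (operatorLayerYS349 𝔸 G x 𝔏 𝔈).E310 = (operatorLayerYOfLetters 𝔸 G x 𝔏 𝔈).E310 := rfl
/-- unchanged field. [cite: Balaban1985BackgroundPropagators, Thm 3.11 p.419, bookkeeping] -/
theorem operatorLayerYS349_PosDef : (operatorLayerYS349 𝔸 G x 𝔏 𝔈).PosDef = (operatorLayerYOfLetters 𝔸 G x 𝔏 𝔈).PosDef := rfl
/-- unchanged field. [cite: Balaban1985BackgroundPropagators, Thm 3.12 p.421, bookkeeping] -/
theorem operatorLayerYS349_GD : (operatorLayerYS349 𝔸 G x 𝔏 𝔈).GD = (operatorLayerYOfLetters 𝔸 G x 𝔏 𝔈).GD := rfl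
/-- unchanged field. [cite: Balaban1985BackgroundPropagators, Thm 3.12 p.421, bookkeeping] -/
theorem operatorLayerYS349_G₁ : (operatorLayerYS349 𝔸 G x 𝔏 𝔈).G₁ = (operatorLayerYOfLetters 𝔸 G x 𝔏 𝔈).G₁ := rfl
/-- unchanged field. [cite: Balaban1985BackgroundPropagators, (3.133) p.422, bookkeeping] -/
theorem operatorLayerYS349_H : (operatorLayerYS349 𝔸 G x 𝔏 𝔈).H = (operatorLayerYOfLetters 𝔸 G x 𝔏 𝔈).H := rfl
/-- unchanged field. [cite: Balaban1985BackgroundPropagators, (3.133) p.422, bookkeeping] -/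
theorem operatorLayerYS349_H₁ : (operatorLayerYS349 𝔸 G x 𝔏 𝔈).H₁ = (operatorLayerYOfLetters 𝔸 G x 𝔏 𝔈).H₁ := rfl
/-- unchanged field. [cite: Balaban1985BackgroundPropagators, Thm 3.12 p.421, bookkeeping] -/
theorem operatorLayerYS349_HasRWExp : (operatorLayerYS349 𝔸 G x 𝔏 𝔈).HasRWExp = (operatorLayerYOfLetters 𝔸 G x 𝔏 𝔈).HasRWExp := rfl
/-- unchanged field. [cite: Balaban1985BackgroundPropagators, Thm 3.12 p.421, bookkeeping] -/
theorem operatorLayerYS349_HasRWExpH : (operatorLayerYS349 𝔸 G x 𝔏 𝔈).HasRWExpH = (operatorLayerYOfLetters 𝔸 G x 𝔏 𝔈).HasRWExpH := rfl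
/-- unchanged field. [cite: Balaban1985BackgroundPropagators, Thm 3.11 p.419, bookkeeping] -/
theorem operatorLayerYS349_PosDefK : (operatorLayerYS349 𝔸 G x 𝔏 𝔈).PosDefK = (operatorLayerYOfLetters 𝔸 G x 𝔏 𝔈).PosDefK := rfl
/-- unchanged field. [cite: Balaban1985BackgroundPropagators, Thm 3.13 p.426, bookkeeping] -/
theorem operatorLayerYS349_GG : (operatorLayerYS349 𝔸 G x 𝔏 𝔈).GG = (operatorLayerYOfLetters 𝔸 G x 𝔏 𝔈).GG := rfl
/-- unchanged field. [cite: Balaban1985BackgroundPropagators, Thm 3.14 p.426, bookkeeping] -/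
theorem operatorLayerYS349_Kdiff : (operatorLayerYS349 𝔸 G x 𝔏 𝔈).Kdiff = (operatorLayerYOfLetters 𝔸 G x 𝔏 𝔈).Kdiff := rfl
/-- unchanged field. [cite: Balaban1985BackgroundPropagators, Thm 3.15 p.432, bookkeeping] -/
theorem operatorLayerYS349_Ck : (operatorLayerYS349 𝔸 G x 𝔏 𝔈).Ck = (operatorLayerYOfLetters 𝔸 G x 𝔏 𝔈).Ck := rfl
/-- unchanged field. [cite: Balaban1985BackgroundPropagators, (3.185) p.432, bookkeeping] -/
theorem operatorLayerYS349_GivenBy3185 : (operatorLayerYS349 𝔸 G x 𝔏 𝔈).GivenBy3185 = (operatorLayerYOfLetters 𝔸 G x 𝔏 𝔈).GivenBy3185 := rfl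
/-- unchanged field. [cite: Balaban1985BackgroundPropagators, Thm 3.15 p.432, bookkeeping] -/
theorem operatorLayerYS349_HasRWExpC : (operatorLayerYS349 𝔸 G x 𝔏 𝔈).HasRWExpC = (operatorLayerYOfLetters 𝔸 G x 𝔏 𝔈).HasRWExpC := rfl
/-- unchanged field. [cite: Balaban1985BackgroundPropagators, (3.132) p.422, bookkeeping] -/
theorem operatorLayerYS349_QGQinv : (operatorLayerYS349 𝔸 G x 𝔏 𝔈).QGQinv = (operatorLayerYOfLetters 𝔸 G x 𝔏 𝔈).QGQinv := rfl
/-- unchanged field. [cite: Balaban1985BackgroundPropagators, (3.132) p.422, bookkeeping] -/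
theorem operatorLayerYS349_QG1Qinv : (operatorLayerYS349 𝔸 G x 𝔏 𝔈).QG1Qinv = (operatorLayerYOfLetters 𝔸 G x 𝔏 𝔈).QG1Qinv := rfl

/-- the layer IS def-Y's layer with the one field replaced (structure update, `rfl`). [cite: Balaban1985BackgroundPropagators, (3.49) p.399, bookkeeping] -/
theorem operatorLayerYS349_eq_update :
    operatorLayerYS349 𝔸 G x 𝔏 𝔈 = { operatorLayerYOfLetters 𝔸 G x 𝔏 𝔈 with P349 := p349SiteY 𝔸 G x 𝔏 } := rfl

/-- at the FLAT letters (`Gp = 0`) the site reading of `P(U) = G′…G′` is again `0` — the reading is faithful to the letter, not a source of content by itself.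
[cite: Balaban1985BackgroundPropagators, (3.49) p.399, (3.25) p.394, bookkeeping] -/
theorem p349SiteY_ker_of_Gp_zero (hGp : 𝔏.Gp = fun _ => 0) (n : Fin 4) (U : (bg9Y 𝔸 G x).Cfg) (b b' : (geo9Y x).Site) :
    (p349SiteY 𝔸 G x 𝔏).ker n U b b' = 0 := by
  have hP : P349Y x.toKIdx 𝔏.parS 𝔏.Gp = fun _ => (0 : (SiteY x.toKIdx → 𝔸) →ₗ[ℂ] (SiteY x.toKIdx → 𝔸)) := by
    funext U
    rw [P349Y_eq_comp, hGp, LinearMap.zero_comp]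
  show (fineKernelOfSiteOp x.toKIdx (bg9Y 𝔸 G x) (fun U => U) (P349Y x.toKIdx 𝔏.parS 𝔏.Gp)).ker n U b b' = 0
  rw [hP]
  exact fineKernelOfSiteOp_zero_ker x.toKIdx (bg9Y 𝔸 G x) (fun U => U) n U b b'

end Layer

section Record

open scoped Matrix.Norms.L2Operator

variable {N : ℕ}

/-- ★★ **THE `OpsY` INSTANCE WITH THE GENUINE (3.49) READING, AS A FUNCTION OF THE LETTERS**: member by member `operatorLayerYS349`.
[cite: Balaban1985BackgroundPropagators, Thms 3.1–3.15 pp.397–432, (3.49) p.399] -/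
def opsYS349OfLetters (N : ℕ) (θ : Stage3Params) (Mstar : ℕ) (𝔏 : LettersY N θ Mstar) (𝔈 : ExpsY N θ Mstar) : OpsY N θ Mstar :=
  fun x => operatorLayerYS349 (Matrix (Fin N) (Fin N) ℂ) (specialUnitaryUnits (Fin N)) x (𝔏 x) (𝔈 x)

/-- ★★ **def-Y's v3 RECORD `opsYOfRecordDE` WITH THE GENUINE SITE-SECTOR (3.49) READING IN `P349`** (every other field `rfl`-equal).
[cite: Balaban1985BackgroundPropagators, Thms 3.1–3.15 pp.397–432, (3.49) p.399] -/
def opsYS349OfRecordDE (N : ℕ) (θ : Stage3Params) (Mstar : ℕ) (𝔯 : ResY N θ Mstar) (𝔈 : ExpsY N θ Mstar) : OpsY N θ Mstar :=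
  opsYS349OfLetters N θ Mstar (lettersYOfRecordDE N θ Mstar 𝔯) 𝔈

variable (θ : Stage3Params) (Mstar : ℕ) (𝔏 : LettersY N θ Mstar) (𝔯 : ResY N θ Mstar) (𝔈 : ExpsY N θ Mstar)
  (x : MemberY θ.d₆ θ.ℓ₆ θ.hd' θ.hL' θ.b₀ θ.b₁ Mstar)

/-- member by member the instance is def-Y's `opsYOfLetters` with the `P349` field replaced (`rfl`). [cite: Balaban1985BackgroundPropagators, (3.49) p.399, bookkeeping] -/
theorem opsYS349OfLetters_apply :
    opsYS349OfLetters N θ Mstar 𝔏 𝔈 x =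
      { opsYOfLetters N θ Mstar 𝔏 𝔈 x with P349 := p349SiteY (Matrix (Fin N) (Fin N) ℂ) (specialUnitaryUnits (Fin N)) x (𝔏 x) } := rfl

/-- row 25's field at the instance: the genuine reading. [cite: Balaban1985BackgroundPropagators, (3.49) p.399, bookkeeping] -/
theorem opsYS349OfLetters_P349 :
    (opsYS349OfLetters N θ Mstar 𝔏 𝔈 x).P349 = p349SiteY (Matrix (Fin N) (Fin N) ℂ) (specialUnitaryUnits (Fin N)) x (𝔏 x) := rfl

/-- unchanged field (rows 1–3, 11, 15–17). [cite: Balaban1985BackgroundPropagators, Thm 3.1 p.397, bookkeeping] -/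
theorem opsYS349OfLetters_Gp : (opsYS349OfLetters N θ Mstar 𝔏 𝔈 x).Gp = (opsYOfLetters N θ Mstar 𝔏 𝔈 x).Gp := rfl
/-- unchanged field (rows 4–8, 12). [cite: Balaban1985BackgroundPropagators, Thm 3.3 p.399, bookkeeping] -/
theorem opsYS349OfLetters_GA : (opsYS349OfLetters N θ Mstar 𝔏 𝔈 x).GA = (opsYOfLetters N θ Mstar 𝔏 𝔈 x).GA := rfl
/-- unchanged field (Thm 3.2). [cite: Balaban1985BackgroundPropagators, Thm 3.2 p.398, bookkeeping] -/
theorem opsYS349OfLetters_Cinv : (opsYS349OfLetters N θ Mstar 𝔏 𝔈 x).Cinv = (opsYOfLetters N θ Mstar 𝔏 𝔈 x).Cinv := rfl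
/-- unchanged field. [cite: Balaban1985BackgroundPropagators, (3.37) p.396, bookkeeping] -/
theorem opsYS349OfLetters_IsAnalyticExt : (opsYS349OfLetters N θ Mstar 𝔏 𝔈 x).IsAnalyticExt = (opsYOfLetters N θ Mstar 𝔏 𝔈 x).IsAnalyticExt := rfl
/-- unchanged field (row 18). [cite: Balaban1985BackgroundPropagators, Thm 3.7 p.409, bookkeeping] -/
theorem opsYS349OfLetters_E37 : (opsYS349OfLetters N θ Mstar 𝔏 𝔈 x).E37 = (opsYOfLetters N θ Mstar 𝔏 𝔈 x).E37 := rfl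
/-- unchanged field (rows 15–16). [cite: Balaban1985BackgroundPropagators, Thm 3.9 p.414, bookkeeping] -/
theorem opsYS349OfLetters_EK39 : (opsYS349OfLetters N θ Mstar 𝔏 𝔈 x).EK39 = (opsYOfLetters N θ Mstar 𝔏 𝔈 x).EK39 := rfl
/-- unchanged field (row 19). [cite: Balaban1985BackgroundPropagators, Thm 3.10 p.416, bookkeeping] -/
theorem opsYS349OfLetters_E310 : (opsYS349OfLetters N θ Mstar 𝔏 𝔈 x).E310 = (opsYOfLetters N θ Mstar 𝔏 𝔈 x).E310 := rfl
/-- unchanged field (row 17). [cite: Balaban1985BackgroundPropagators, Thm 3.11 p.419, bookkeeping] -/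
theorem opsYS349OfLetters_PosDef : (opsYS349OfLetters N θ Mstar 𝔏 𝔈 x).PosDef = (opsYOfLetters N θ Mstar 𝔏 𝔈 x).PosDef := rfl
/-- unchanged field (row 20). [cite: Balaban1985BackgroundPropagators, Thm 3.12 p.421, bookkeeping] -/
theorem opsYS349OfLetters_GD : (opsYS349OfLetters N θ Mstar 𝔏 𝔈 x).GD = (opsYOfLetters N θ Mstar 𝔏 𝔈 x).GD := rfl
/-- unchanged field (row 20). [cite: Balaban1985BackgroundPropagators, Thm 3.12 p.421, bookkeeping] -/
theorem opsYS349OfLetters_G₁ : (opsYS349OfLetters N θ Mstar 𝔏 𝔈 x).G₁ = (opsYOfLetters N θ Mstar 𝔏 𝔈 x).G₁ := rfl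
/-- unchanged field (row 20). [cite: Balaban1985BackgroundPropagators, (3.133) p.422, bookkeeping] -/
theorem opsYS349OfLetters_H : (opsYS349OfLetters N θ Mstar 𝔏 𝔈 x).H = (opsYOfLetters N θ Mstar 𝔏 𝔈 x).H := rfl
/-- unchanged field (row 20). [cite: Balaban1985BackgroundPropagators, (3.133) p.422, bookkeeping] -/
theorem opsYS349OfLetters_H₁ : (opsYS349OfLetters N θ Mstar 𝔏 𝔈 x).H₁ = (opsYOfLetters N θ Mstar 𝔏 𝔈 x).H₁ := rfl
/-- unchanged field (rows 20–21). [cite: Balaban1985BackgroundPropagators, Thm 3.12 p.421, bookkeeping] -/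
theorem opsYS349OfLetters_HasRWExp : (opsYS349OfLetters N θ Mstar 𝔏 𝔈 x).HasRWExp = (opsYOfLetters N θ Mstar 𝔏 𝔈 x).HasRWExp := rfl
/-- unchanged field (row 20). [cite: Balaban1985BackgroundPropagators, Thm 3.12 p.421, bookkeeping] -/
theorem opsYS349OfLetters_HasRWExpH : (opsYS349OfLetters N θ Mstar 𝔏 𝔈 x).HasRWExpH = (opsYOfLetters N θ Mstar 𝔏 𝔈 x).HasRWExpH := rfl
/-- unchanged field (rows 20–21). [cite: Balaban1985BackgroundPropagators, Thm 3.11 p.419, bookkeeping] -/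
theorem opsYS349OfLetters_PosDefK : (opsYS349OfLetters N θ Mstar 𝔏 𝔈 x).PosDefK = (opsYOfLetters N θ Mstar 𝔏 𝔈 x).PosDefK := rfl
/-- unchanged field (row 21). [cite: Balaban1985BackgroundPropagators, Thm 3.13 p.426, bookkeeping] -/
theorem opsYS349OfLetters_GG : (opsYS349OfLetters N θ Mstar 𝔏 𝔈 x).GG = (opsYOfLetters N θ Mstar 𝔏 𝔈 x).GG := rfl
/-- unchanged field (row 22). [cite: Balaban1985BackgroundPropagators, Thm 3.14 p.426, bookkeeping] -/
theorem opsYS349OfLetters_Kdiff : (opsYS349OfLetters N θ Mstar 𝔏 𝔈 x).Kdiff = (opsYOfLetters N θ Mstar 𝔏 𝔈 x).Kdiff := rfl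
/-- unchanged field (rows 23–24). [cite: Balaban1985BackgroundPropagators, Thm 3.15 p.432, bookkeeping] -/
theorem opsYS349OfLetters_Ck : (opsYS349OfLetters N θ Mstar 𝔏 𝔈 x).Ck = (opsYOfLetters N θ Mstar 𝔏 𝔈 x).Ck := rfl
/-- unchanged field (row 23). [cite: Balaban1985BackgroundPropagators, (3.185) p.432, bookkeeping] -/
theorem opsYS349OfLetters_GivenBy3185 : (opsYS349OfLetters N θ Mstar 𝔏 𝔈 x).GivenBy3185 = (opsYOfLetters N θ Mstar 𝔏 𝔈 x).GivenBy3185 := rfl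
/-- unchanged field (row 24). [cite: Balaban1985BackgroundPropagators, Thm 3.15 p.432, bookkeeping] -/
theorem opsYS349OfLetters_HasRWExpC : (opsYS349OfLetters N θ Mstar 𝔏 𝔈 x).HasRWExpC = (opsYOfLetters N θ Mstar 𝔏 𝔈 x).HasRWExpC := rfl
/-- unchanged field (row 26). [cite: Balaban1985BackgroundPropagators, (3.132) p.422, bookkeeping] -/
theorem opsYS349OfLetters_QGQinv : (opsYS349OfLetters N θ Mstar 𝔏 𝔈 x).QGQinv = (opsYOfLetters N θ Mstar 𝔏 𝔈 x).QGQinv := rfl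
/-- unchanged field (row 26). [cite: Balaban1985BackgroundPropagators, (3.132) p.422, bookkeeping] -/
theorem opsYS349OfLetters_QG1Qinv : (opsYS349OfLetters N θ Mstar 𝔏 𝔈 x).QG1Qinv = (opsYOfLetters N θ Mstar 𝔏 𝔈 x).QG1Qinv := rfl

/-- the record variant, unfolded: def-Y's `opsYOfRecordDE` with the `P349` field replaced (`rfl`). [cite: Balaban1985BackgroundPropagators, (3.49) p.399, bookkeeping] -/
theorem opsYS349OfRecordDE_apply :
    opsYS349OfRecordDE N θ Mstar 𝔯 𝔈 x =
      { opsYOfRecordDE N θ Mstar 𝔯 𝔈 x with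
        P349 := p349SiteY (Matrix (Fin N) (Fin N) ℂ) (specialUnitaryUnits (Fin N)) x (lettersYOfRecordDE N θ Mstar 𝔯 x) } := rfl

/-- ★ **ROW 25's FIELD AT THE v3 RECORD: THE (3.49) READING OF THE GENUINE `P = G′Q′*(Q′G′²Q′*)⁻¹Q′G′` OVER def-Y's TAXICAB TRANSPORTERS AND `G′ = GpY`.**
[cite: Balaban1985BackgroundPropagators, (3.49) p.399 with (3.25) p.394] -/
theorem opsYS349OfRecordDE_P349 :
    (opsYS349OfRecordDE N θ Mstar 𝔯 𝔈 x).P349 =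
      fineKernelOfSiteOp x.toKIdx (bg9Y (Matrix (Fin N) (Fin N) ℂ) (specialUnitaryUnits (Fin N)) x) (fun U => U)
        (P349Y x.toKIdx (parSY x.toKIdx) (GpY x.toKIdx (parSY x.toKIdx))) := rfl

/-- every field but `P349` is def-Y's `opsYOfRecordDE`'s: the `Gp` field. [cite: Balaban1985BackgroundPropagators, Thm 3.1 p.397, bookkeeping] -/
theorem opsYS349OfRecordDE_Gp : (opsYS349OfRecordDE N θ Mstar 𝔯 𝔈 x).Gp = (opsYOfRecordDE N θ Mstar 𝔯 𝔈 x).Gp := rfl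
/-- … the `GA` field. [cite: Balaban1985BackgroundPropagators, Thm 3.3 p.399, bookkeeping] -/
theorem opsYS349OfRecordDE_GA : (opsYS349OfRecordDE N θ Mstar 𝔯 𝔈 x).GA = (opsYOfRecordDE N θ Mstar 𝔯 𝔈 x).GA := rfl
/-- … the `Cinv` field. [cite: Balaban1985BackgroundPropagators, Thm 3.2 p.398, bookkeeping] -/
theorem opsYS349OfRecordDE_Cinv : (opsYS349OfRecordDE N θ Mstar 𝔯 𝔈 x).Cinv = (opsYOfRecordDE N θ Mstar 𝔯 𝔈 x).Cinv := rfl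
/-- … the `GD` field. [cite: Balaban1985BackgroundPropagators, Thm 3.12 p.421, bookkeeping] -/
theorem opsYS349OfRecordDE_GD : (opsYS349OfRecordDE N θ Mstar 𝔯 𝔈 x).GD = (opsYOfRecordDE N θ Mstar 𝔯 𝔈 x).GD := rfl
/-- … the `G₁` field. [cite: Balaban1985BackgroundPropagators, Thm 3.12 p.421, bookkeeping] -/
theorem opsYS349OfRecordDE_G₁ : (opsYS349OfRecordDE N θ Mstar 𝔯 𝔈 x).G₁ = (opsYOfRecordDE N θ Mstar 𝔯 𝔈 x).G₁ := rfl
/-- … the `H` field. [cite: Balaban1985BackgroundPropagators, (3.133) p.422, bookkeeping] -/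
theorem opsYS349OfRecordDE_H : (opsYS349OfRecordDE N θ Mstar 𝔯 𝔈 x).H = (opsYOfRecordDE N θ Mstar 𝔯 𝔈 x).H := rfl
/-- … the `H₁` field. [cite: Balaban1985BackgroundPropagators, (3.133) p.422, bookkeeping] -/
theorem opsYS349OfRecordDE_H₁ : (opsYS349OfRecordDE N θ Mstar 𝔯 𝔈 x).H₁ = (opsYOfRecordDE N θ Mstar 𝔯 𝔈 x).H₁ := rfl
/-- … the `GG` field. [cite: Balaban1985BackgroundPropagators, Thm 3.13 p.426, bookkeeping] -/
theorem opsYS349OfRecordDE_GG : (opsYS349OfRecordDE N θ Mstar 𝔯 𝔈 x).GG = (opsYOfRecordDE N θ Mstar 𝔯 𝔈 x).GG := rfl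
/-- … the `Kdiff` field. [cite: Balaban1985BackgroundPropagators, Thm 3.14 p.426, bookkeeping] -/
theorem opsYS349OfRecordDE_Kdiff : (opsYS349OfRecordDE N θ Mstar 𝔯 𝔈 x).Kdiff = (opsYOfRecordDE N θ Mstar 𝔯 𝔈 x).Kdiff := rfl
/-- … the `Ck` field. [cite: Balaban1985BackgroundPropagators, Thm 3.15 p.432, bookkeeping] -/
theorem opsYS349OfRecordDE_Ck : (opsYS349OfRecordDE N θ Mstar 𝔯 𝔈 x).Ck = (opsYOfRecordDE N θ Mstar 𝔯 𝔈 x).Ck := rfl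
/-- … the `QGQinv` field. [cite: Balaban1985BackgroundPropagators, (3.132) p.422, bookkeeping] -/
theorem opsYS349OfRecordDE_QGQinv : (opsYS349OfRecordDE N θ Mstar 𝔯 𝔈 x).QGQinv = (opsYOfRecordDE N θ Mstar 𝔯 𝔈 x).QGQinv := rfl
/-- … the `QG1Qinv` field. [cite: Balaban1985BackgroundPropagators, (3.132) p.422, bookkeeping] -/
theorem opsYS349OfRecordDE_QG1Qinv : (opsYS349OfRecordDE N θ Mstar 𝔯 𝔈 x).QG1Qinv = (opsYOfRecordDE N θ Mstar 𝔯 𝔈 x).QG1Qinv := rfl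
/-- … the `IsAnalyticExt` field. [cite: Balaban1985BackgroundPropagators, (3.37) p.396, bookkeeping] -/
theorem opsYS349OfRecordDE_IsAnalyticExt : (opsYS349OfRecordDE N θ Mstar 𝔯 𝔈 x).IsAnalyticExt = (opsYOfRecordDE N θ Mstar 𝔯 𝔈 x).IsAnalyticExt := rfl
/-- … the `E37` field. [cite: Balaban1985BackgroundPropagators, Thm 3.7 p.409, bookkeeping] -/
theorem opsYS349OfRecordDE_E37 : (opsYS349OfRecordDE N θ Mstar 𝔯 𝔈 x).E37 = (opsYOfRecordDE N θ Mstar 𝔯 𝔈 x).E37 := rfl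
/-- … the `EK39` field. [cite: Balaban1985BackgroundPropagators, Thm 3.9 p.414, bookkeeping] -/
theorem opsYS349OfRecordDE_EK39 : (opsYS349OfRecordDE N θ Mstar 𝔯 𝔈 x).EK39 = (opsYOfRecordDE N θ Mstar 𝔯 𝔈 x).EK39 := rfl
/-- … the `E310` field. [cite: Balaban1985BackgroundPropagators, Thm 3.10 p.416, bookkeeping] -/
theorem opsYS349OfRecordDE_E310 : (opsYS349OfRecordDE N θ Mstar 𝔯 𝔈 x).E310 = (opsYOfRecordDE N θ Mstar 𝔯 𝔈 x).E310 := rfl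
/-- … the `PosDef` field. [cite: Balaban1985BackgroundPropagators, Thm 3.11 p.419, bookkeeping] -/
theorem opsYS349OfRecordDE_PosDef : (opsYS349OfRecordDE N θ Mstar 𝔯 𝔈 x).PosDef = (opsYOfRecordDE N θ Mstar 𝔯 𝔈 x).PosDef := rfl
/-- … the `HasRWExp` field. [cite: Balaban1985BackgroundPropagators, Thm 3.12 p.421, bookkeeping] -/
theorem opsYS349OfRecordDE_HasRWExp : (opsYS349OfRecordDE N θ Mstar 𝔯 𝔈 x).HasRWExp = (opsYOfRecordDE N θ Mstar 𝔯 𝔈 x).HasRWExp := rfl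
/-- … the `HasRWExpH` field. [cite: Balaban1985BackgroundPropagators, Thm 3.12 p.421, bookkeeping] -/
theorem opsYS349OfRecordDE_HasRWExpH : (opsYS349OfRecordDE N θ Mstar 𝔯 𝔈 x).HasRWExpH = (opsYOfRecordDE N θ Mstar 𝔯 𝔈 x).HasRWExpH := rfl
/-- … the `PosDefK` field. [cite: Balaban1985BackgroundPropagators, Thm 3.11 p.419, bookkeeping] -/
theorem opsYS349OfRecordDE_PosDefK : (opsYS349OfRecordDE N θ Mstar 𝔯 𝔈 x).PosDefK = (opsYOfRecordDE N θ Mstar 𝔯 𝔈 x).PosDefK := rfl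
/-- … the `GivenBy3185` field. [cite: Balaban1985BackgroundPropagators, (3.185) p.432, bookkeeping] -/
theorem opsYS349OfRecordDE_GivenBy3185 : (opsYS349OfRecordDE N θ Mstar 𝔯 𝔈 x).GivenBy3185 = (opsYOfRecordDE N θ Mstar 𝔯 𝔈 x).GivenBy3185 := rfl
/-- … the `HasRWExpC` field. [cite: Balaban1985BackgroundPropagators, Thm 3.15 p.432, bookkeeping] -/
theorem opsYS349OfRecordDE_HasRWExpC : (opsYS349OfRecordDE N θ Mstar 𝔯 𝔈 x).HasRWExpC = (opsYOfRecordDE N θ Mstar 𝔯 𝔈 x).HasRWExpC := rfl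

/-- the [B9] bundle of record at the instance (`rfl`). [cite: Balaban1985BackgroundPropagators, Thms 3.1–3.15 pp.397–432, bookkeeping] -/
theorem Y9OfRecord_opsYS349OfRecordDE :
    Y9OfRecord N θ Mstar (opsYS349OfRecordDE N θ Mstar 𝔯 𝔈) =
      carriersY θ.d₆ θ.ℓ₆ θ.hd' θ.hL' θ.b₀ θ.b₁ Mstar (Matrix (Fin N) (Fin N) ℂ) (specialUnitaryUnits (Fin N)) (opsYS349OfRecordDE N θ Mstar 𝔯 𝔈) := rfl

/-- ★ **ROW 25 AT THIS INSTANCE IS THE GENUINE OBLIGATION**: the knit's binder `s349 : B9.Stmt349Printed d′ c35 geo9Y (bg9Y …) (x ↦ (ops x).P349)` at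
`ops := opsYS349OfLetters N θ M⋆ 𝔏 𝔈` IS print's (3.49) for the site reading of `P = I − R(U)` over `𝔏`'s own `parS`, `Gp` (`Iff.rfl`) — a HYPOTHESIS about a
genuine operator (at def-Y's records: non-vacuous), where `opsYOfLetters` reads the flat bond-sector slot.
[cite: Balaban1985BackgroundPropagators, (3.49) p.399] -/
theorem s349_opsYS349OfLetters_iff (dd : ℕ) (c35 : ℝ) :
    B9.Stmt349Printed dd c35 (geo9Y (d := θ.d₆) (ℓ := θ.ℓ₆) (hd := θ.hd') (hL := θ.hL') (b₀ := θ.b₀) (b₁ := θ.b₁) (Mstar := Mstar))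
        (bg9Y (Matrix (Fin N) (Fin N) ℂ) (specialUnitaryUnits (Fin N))) (fun x => (opsYS349OfLetters N θ Mstar 𝔏 𝔈 x).P349) ↔
      B9.Stmt349Printed dd c35 (geo9Y (d := θ.d₆) (ℓ := θ.ℓ₆) (hd := θ.hd') (hL := θ.hL') (b₀ := θ.b₀) (b₁ := θ.b₁) (Mstar := Mstar))
        (bg9Y (Matrix (Fin N) (Fin N) ℂ) (specialUnitaryUnits (Fin N)))
        (fun x => p349SiteY (Matrix (Fin N) (Fin N) ℂ) (specialUnitaryUnits (Fin N)) x (𝔏 x)) := Iff.rfl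

end Record

end

end Literature.MathematicalPhysics.QuantumFieldTheory.Balaban1983to89.B9Ineq349SiteReading
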